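import Mathlib
import HarnessLib
import Literature.MathematicalPhysics.StatisticalMechanics.RenormalisationMap
import Literature.MathematicalPhysics.StatisticalMechanics.RelevantHamiltonianDerivatives

/-!
# Crux `HypACumulant`, line `gnv` — the block factors `e^{−(H+σU)(B,φ)}`, `1 − e^{−(H+σU)(B,φ)}` and
# their block products are ENTIRE in the complex parameter `σ` and jointly smooth in `(σ, φ)`

Route `route-HubbardSuperconductivity-ComplexGFFStiffness`, cruxes stmt-HubbardSuperconductivity-19154 /
-19155, shared research statement `OnePointLipschitz`, census (C3d′): first brick of the structural pass
over the renormalisation map `T_k` ([ABKM19] Definition 6.5) feeding the holomorphic-family engine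
(`…HolomorphicFamilies(Finite)`, `…HolomorphicNormsFinite`).  Along a complex line `H + σU` of relevant
Hamiltonians (`RelevantHamiltonian ℂ d`, no reality condition):

* `eval_add_smul` — `(H + σU)(B, φ) = H(B,φ) + σ·U(B,φ)` (linearity of `eval`);
* `contDiff_expNegH_line`, `differentiable_expNegH_line` — `(σ, φ) ↦ e^{−(H+σU)(B,φ)}` is jointly `C^∞`
  and, for each `φ`, entire in `σ`; the same for `1 − e^{−(H+σU)(B,φ)}` and for the block products
  `(e^{−(H+σU)})^Z`, `(1 − e^{−(H+σU)})^Z` (`contDiff_bprod_expNegH_line`, `differentiable_bprod_expNegH_line`, …).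

All proved, no `sorry`.

## References
* S. Adams, S. Buchholz, R. Kotecký, S. Müller, arXiv:1910.13564, Definition 6.5, (6.18), Lemma 9.3
  [AdamsBuchholzKoteckyMuller2019].
-/

noncomputable section

-- `Summit.<Summit>.<Problem>`: single-conjunct summit, the duplicate component is mandated (D-0017).
set_option linter.dupNamespace false

namespace Summit.HubbardSuperconductivity.HubbardSuperconductivity.Theorems.ComplexGFF

open Literature.MathematicalPhysics.StatisticalMechanics.GradientRG
open Literature.MathematicalPhysics.StatisticalMechanics.TorusPolymer (bprod blocks)
open Literature.MathematicalPhysics.StatisticalMechanics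

variable {d M : ℕ} [NeZero M]

omit [NeZero M] in
/-- `(H + σU)(B, φ) = H(B, φ) + σ·U(B, φ)`. -/
theorem eval_add_smul (H U : RelevantHamiltonian ℂ d) (σ : ℂ) (B : Finset (Fin d → ZMod M))
    (φ : (Fin d → ZMod M) → ℝ) : eval (H + σ • U) B φ = eval H B φ + σ * eval U B φ := by
  rw [eval_add, eval_smul]

/-- joint smoothness of `(σ, φ) ↦ (H + σU)(B, φ)`. -/
theorem contDiff_eval_line (H U : RelevantHamiltonian ℂ d) (B : Finset (Fin d → ZMod M)) {n : WithTop ℕ∞} :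
    ContDiff ℝ n (fun p : ℂ × ((Fin d → ZMod M) → ℝ) => eval (H + p.1 • U) B p.2) := by
  have e : (fun p : ℂ × ((Fin d → ZMod M) → ℝ) => eval (H + p.1 • U) B p.2)
      = fun p => eval H B p.2 + p.1 * eval U B p.2 := by
    funext p; exact eval_add_smul H U p.1 B p.2
  rw [e]
  exact ((contDiff_eval H B).comp contDiff_snd).add (contDiff_fst.mul ((contDiff_eval U B).comp contDiff_snd))

/-- **`(σ, φ) ↦ e^{−(H+σU)(B,φ)}` is jointly `C^∞`.** -/
theorem contDiff_expNegH_line (H U : RelevantHamiltonian ℂ d) (B : Finset (Fin d → ZMod M)) {n : WithTop ℕ∞} :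
    ContDiff ℝ n (fun p : ℂ × ((Fin d → ZMod M) → ℝ) => expNegH (H + p.1 • U) B p.2) := by
  unfold expNegH
  exact (contDiff_eval_line H U B).neg.cexp

omit [NeZero M] in
/-- **`σ ↦ e^{−(H+σU)(B,φ)}` is entire** for every field `φ`. -/
theorem differentiable_expNegH_line (H U : RelevantHamiltonian ℂ d) (B : Finset (Fin d → ZMod M))
    (φ : (Fin d → ZMod M) → ℝ) : Differentiable ℂ (fun σ : ℂ => expNegH (H + σ • U) B φ) := by
  unfold expNegH
  have e : (fun σ : ℂ => Complex.exp (-eval (H + σ • U) B φ))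
      = fun σ => Complex.exp (-(eval H B φ + σ * eval U B φ)) := by
    funext σ; rw [eval_add_smul]
  rw [e]
  exact ((differentiable_const _).add (differentiable_id.mul (differentiable_const _))).neg.cexp

/-- `(σ, φ) ↦ 1 − e^{−(H+σU)(B,φ)}` is jointly `C^∞`. -/
theorem contDiff_one_sub_expNegH_line (H U : RelevantHamiltonian ℂ d) (B : Finset (Fin d → ZMod M))
    {n : WithTop ℕ∞} :
    ContDiff ℝ n (fun p : ℂ × ((Fin d → ZMod M) → ℝ) => 1 - expNegH (H + p.1 • U) B p.2) :=
  contDiff_const.sub (contDiff_expNegH_line H U B)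

omit [NeZero M] in
/-- `σ ↦ 1 − e^{−(H+σU)(B,φ)}` is entire. -/
theorem differentiable_one_sub_expNegH_line (H U : RelevantHamiltonian ℂ d) (B : Finset (Fin d → ZMod M))
    (φ : (Fin d → ZMod M) → ℝ) : Differentiable ℂ (fun σ : ℂ => 1 - expNegH (H + σ • U) B φ) :=
  (differentiable_const _).sub (differentiable_expNegH_line H U B φ)

/-- **Block products `(e^{−(H+σU)})^Z` are jointly `C^∞` in `(σ, φ)`.** -/
theorem contDiff_bprod_expNegH_line (s : ℕ) (H U : RelevantHamiltonian ℂ d) (Z : Finset (Fin d → ZMod M))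
    {n : WithTop ℕ∞} :
    ContDiff ℝ n (fun p : ℂ × ((Fin d → ZMod M) → ℝ) => bprod s (fun B => expNegH (H + p.1 • U) B p.2) Z) := by
  unfold bprod
  exact contDiff_prod fun B _ => contDiff_expNegH_line H U B

/-- Block products `(e^{−(H+σU)})^Z` are entire in `σ`. -/
theorem differentiable_bprod_expNegH_line (s : ℕ) (H U : RelevantHamiltonian ℂ d) (Z : Finset (Fin d → ZMod M))
    (φ : (Fin d → ZMod M) → ℝ) :
    Differentiable ℂ (fun σ : ℂ => bprod s (fun B => expNegH (H + σ • U) B φ) Z) := by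
  unfold bprod
  have h := Differentiable.finsetProd (u := TorusPolymer.blocks s Z) fun B _ => differentiable_expNegH_line H U B φ
  rw [Finset.prod_fn] at h
  exact h

/-- Block products `(1 − e^{−(H+σU)})^Z` are jointly `C^∞` in `(σ, φ)`. -/
theorem contDiff_bprod_one_sub_expNegH_line (s : ℕ) (H U : RelevantHamiltonian ℂ d) (Z : Finset (Fin d → ZMod M))
    {n : WithTop ℕ∞} :
    ContDiff ℝ n (fun p : ℂ × ((Fin d → ZMod M) → ℝ) => bprod s (fun B => 1 - expNegH (H + p.1 • U) B p.2) Z) := by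
  unfold bprod
  exact contDiff_prod fun B _ => contDiff_one_sub_expNegH_line H U B

/-- Block products `(1 − e^{−(H+σU)})^Z` are entire in `σ`. -/
theorem differentiable_bprod_one_sub_expNegH_line (s : ℕ) (H U : RelevantHamiltonian ℂ d)
    (Z : Finset (Fin d → ZMod M)) (φ : (Fin d → ZMod M) → ℝ) :
    Differentiable ℂ (fun σ : ℂ => bprod s (fun B => 1 - expNegH (H + σ • U) B φ) Z) := by
  unfold bprod
  have h := Differentiable.finsetProd (u := TorusPolymer.blocks s Z) fun B _ => differentiable_one_sub_expNegH_line H U B φ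
  rw [Finset.prod_fn] at h
  exact h

/-- Block products `(e^{−(H+σU)} − 1)^Z` (the factor `I − 1` of `midK`) are jointly `C^∞` in `(σ, φ + ξ)`-type
arguments: here in `(σ, φ)`. -/
theorem contDiff_bprod_expNegH_sub_one_line (s : ℕ) (H U : RelevantHamiltonian ℂ d) (Z : Finset (Fin d → ZMod M))
    {n : WithTop ℕ∞} :
    ContDiff ℝ n (fun p : ℂ × ((Fin d → ZMod M) → ℝ) => bprod s (fun B => expNegH (H + p.1 • U) B p.2 - 1) Z) := by
  unfold bprod
  exact contDiff_prod fun B _ => (contDiff_expNegH_line H U B).sub contDiff_const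

/-- Block products `(e^{−(H+σU)} − 1)^Z` are entire in `σ`. -/
theorem differentiable_bprod_expNegH_sub_one_line (s : ℕ) (H U : RelevantHamiltonian ℂ d)
    (Z : Finset (Fin d → ZMod M)) (φ : (Fin d → ZMod M) → ℝ) :
    Differentiable ℂ (fun σ : ℂ => bprod s (fun B => expNegH (H + σ • U) B φ - 1) Z) := by
  unfold bprod
  have h := Differentiable.finsetProd (u := TorusPolymer.blocks s Z)
    fun B _ => (differentiable_expNegH_line H U B φ).sub (differentiable_const (1 : ℂ))
  rw [Finset.prod_fn] at h
  exact h

end Summit.HubbardSuperconductivity.HubbardSuperconductivity.Theorems.ComplexGFF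

end
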